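import Literature.NumberTheory.GaloisRepresentations.IntegralGaloisAction
import Literature.NumberTheory.EllipticCurves.TateModule
import Literature.NumberTheory.EllipticCurves.Tamagawa
import Literature.NumberTheory.EllipticCurves.Isogeny
import HarnessLib

/-!
# Serre 1968, IV-A.2: the `p`-adic representation of a non-CM elliptic curve over `ℚ` with good ordinary
reduction at `p` is locally NON-SPLIT at `p` (named fact, D-0014)

Let `E/ℚ` be an elliptic curve with good ORDINARY reduction at a prime `p` and let `𝔔` be a prime of the ring
`\bar ℤ_ℚ = absIntegers (𝓞 ℚ) ℚ` of all algebraic integers above `p`, with decomposition and inertia groups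
`D_𝔔 ⊇ I_𝔔` in `Γ_ℚ = Gal(ℚ̄/ℚ)` (`Ideal.decompositionSubgroup`, Mathlib's `Ideal.inertia`). The restriction of
`E[p^∞] = E(ℚ̄)[p^∞]` to `D_𝔔` is an extension of the unramified (étale) part `Ẽ[p^∞]` by the connected part
`Ê[p^∞]` (the kernel of reduction; on `Ê[p]` the inertia group acts through the cyclotomic character `ω`, which is
onto `𝔽_pˣ` because `ℚ` is unramified at `p`: Serre 1972, §1.11 Prop. 11 and Cor.). SERRE'S THEOREM (Serre 1968,
*Abelian ℓ-adic representations and elliptic curves*, Ch. IV, Appendix A.2; via Tate 1967, Thm. 4 — full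
faithfulness of `G ↦ T_p G` on `p`-divisible groups over `ℤ_p` — and the Serre–Tate theory of the canonical lift):
if `E` has NO complex multiplication (over `ℚ̄`), this extension is NON-SPLIT, i.e. `E[p^∞]` has no
`D_𝔔`-stable subgroup complementary to `Ê[p^∞]`; a splitting would make `E/ℤ_p` the canonical lift of its
reduction, hence `End(E) ⊋ ℤ`. For CM curves with good ordinary reduction the extension IS split, so the hypothesis
`¬ HasCM` is necessary. (This is the weight-2, `ℚ(f) = ℚ` case of Greenberg's question on local splitting of
ordinary modular Galois representations; cf. Ghate's survey, arXiv:1807.02499, p. 3.)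

## Content (statements only; nothing is proved here)

* `Serre1968.IsOrdinaryLineAt W p 𝔔 X₀` — `X₀ ≤ E[p^∞]` is a non-zero subgroup killed by `p` on which every element
  of `I_𝔔` acts by an integer scalar and some element by a scalar `≢ 1 (mod p)`. For `p ≥ 3` and good ordinary
  reduction the only such `X₀` is the kernel-of-reduction line `Ê[p]` (Serre 1972, §1.11); for `p = 2` no `X₀`
  qualifies (a scalar `a` with `2 ∤ a − 1` kills a `2`-torsion group), so everything below is vacuous at `p = 2`.
  This phrasing avoids a reduction map on `E(ℚ̄)`, which the tree does not have; existence of the line for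
  `p` good ordinary is the tree theorem `WeierstrassCurve.exists_ordinaryLine` (MatarNekovar2019).
* `Serre1968.HasNoStableComplementAt W p 𝔔 X₀` — every `D_𝔔`-stable subgroup `L₀ ≤ E[p^∞]` with `L₀ ⊓ X₀ = ⊥` is
  FINITE. For `X₀ = Ê[p]` this is EQUIVALENT to the non-splitness of `T_pE|_{D_𝔔}`: an infinite `D_𝔔`-stable `L₀`
  missing `Ê[p]` has cyclic layers, hence divisible part `≅ ℚ_p/ℤ_p` meeting `Ê[p^∞]` trivially, and counting
  orders gives `E[p^∞] = Ê[p^∞] ⊕ L₀^{div}` as `D_𝔔`-modules; conversely a splitting provides such an `L₀`.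
* `Serre1968.LocallyNonsplitAt W p 𝔔` — every ordinary line at `𝔔` has no stable complement.
* `serre1968_locallyNonsplit_of_not_hasCM : Prop` — THE NAMED FACT: for every elliptic `E/ℚ` (globally minimal
  model, so that `frobeniusTrace` and `HasGoodReductionAtPrime` apply) without CM, every prime `ℓ` of good
  ordinary reduction (`ℓ ∤ a_ℓ`), every place `u` of `ℚ` with `primesEquiv u = ℓ` and every `𝔔 ∈ u.primesAbove`:
  `LocallyNonsplitAt E ℓ 𝔔`.

## Design choices / what is NOT here

* GLOBAL decomposition groups `D_𝔔 ≤ Γ_ℚ` are used (the tree's dictionary with `Gal(ℚ̄_p/ℚ_p)` is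
  `decompositionSubgroup_adicCompletionPrime_eq_range` in `DecompositionGroupOfCompletion.lean`), and subgroups of
  the discrete module `E[p^∞] = W.geomPrimaryTorsion p` rather than `ℤ_p`-lattices in `T_pE` (equivalent, see
  above; the torsion form is what Selmer-group consumers use).
* `HasCM` is the tree's GEOMETRIC complex multiplication (`Isogeny.lean`), exactly Serre's hypothesis.
* Not here: the proof (Tate's theorem on `p`-divisible groups and Serre–Tate canonical lifts are not in the tree),
  the converse for CM curves, the potentially-good / multiplicative cases, and base change. The statements were
  first typed (with identical bodies, names `OrdinaryLineAbs`, `NoStableComplementAbs`, `SerreNonsplitAt`,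
  `Serre1968OrdinaryNonsplit`) in the BSD crux workfile
  `Summits/BirchSwinnertonDyer/BirchSwinnertonDyer/Cruxes/TwoVariableEulerSystemDivisibility/KatoLineSupply.lean`
  (section `SerreForm`), where the transport to an imaginary quadratic base change at a split `p` is proved and the
  fact is consumed by the bottom-layer control of a `ℤ_p²`-Selmer group; moving the statement here lets that
  consumer cite a Literature name.

Sources: J.-P. Serre, *Abelian ℓ-adic representations and elliptic curves* (Benjamin 1968), Ch. IV, A.2;
J. Tate, *p-divisible groups* (Driebergen 1966, Springer 1967), Thm. 4; J.-P. Serre, Invent. Math. 15 (1972),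
§1.11 Prop. 11 and Cor.; E. Ghate, arXiv:1807.02499, p. 3.
-/

open IsDedekindDomain NumberField Literature.NumberTheory.GaloisRepresentations

namespace Literature.NumberTheory.EllipticCurves

namespace Serre1968

/-- **An ordinary line at the prime `𝔔` of `\bar ℤ_ℚ`** (Serre 1972, §1.11 Prop. 11 and Cor., abstract form):
a non-zero subgroup `X₀ ≤ E(ℚ̄)[p^∞]` killed by `p` such that every element of the inertia group
`I_𝔔 = 𝔔.inertia Γ_ℚ` acts on `X₀` by an integer scalar, and some element of `I_𝔔` acts by a scalar
`a ≢ 1 (mod p)`. At a prime of good ordinary reduction, `p ≥ 3`, the kernel-of-reduction line `Ê[p]` is the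
unique such subgroup (inertia acts on it through the cyclotomic character `ω`, onto `𝔽_pˣ`).
[cite: Serre1972, §1.11 Prop. 11 and Cor.] -/
def IsOrdinaryLineAt (W : WeierstrassCurve ℚ) (p : ℕ) [Fact p.Prime] (𝔔 : Ideal (absIntegers (𝓞 ℚ) ℚ))
    (X₀ : AddSubgroup (W.geomPrimaryTorsion p)) : Prop :=
  X₀ ≠ ⊥ ∧ (∀ x ∈ X₀, p • x = 0) ∧
    (∀ t ∈ 𝔔.inertia (Field.absoluteGaloisGroup ℚ), ∃ c : ℤ, ∀ x ∈ X₀, t • x = c • x) ∧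
    ∃ σ ∈ 𝔔.inertia (Field.absoluteGaloisGroup ℚ), ∃ a : ℤ, ¬ (p : ℤ) ∣ a - 1 ∧ ∀ x ∈ X₀, σ • x = a • x

/-- **No `D_𝔔`-stable complement** (the content of Serre 1968, IV-A.2, in torsion form): every subgroup
`L₀ ≤ E(ℚ̄)[p^∞]` that is stable under the decomposition group `D_𝔔 = 𝔔.decompositionSubgroup Γ_ℚ` and meets `X₀`
trivially is FINITE. For `X₀` the ordinary line `Ê[p]` this says precisely that `E[p^∞]|_{D_𝔔}` (equivalently
`T_pE|_{D_𝔔}`) is a NON-SPLIT extension of its étale quotient by `Ê[p^∞]`. [cite: Serre1968, IV-A.2] -/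
def HasNoStableComplementAt (W : WeierstrassCurve ℚ) (p : ℕ) [Fact p.Prime]
    (𝔔 : Ideal (absIntegers (𝓞 ℚ) ℚ)) (X₀ : AddSubgroup (W.geomPrimaryTorsion p)) : Prop :=
  ∀ L₀ : AddSubgroup (W.geomPrimaryTorsion p),
    (∀ d ∈ 𝔔.decompositionSubgroup (Field.absoluteGaloisGroup ℚ), ∀ m ∈ L₀, d • m ∈ L₀) →
      L₀ ⊓ X₀ = ⊥ → (L₀ : Set (W.geomPrimaryTorsion p)).Finite

/-- **Local non-splitness of `E[p^∞]` at `𝔔`, typed**: every ordinary line at `𝔔` has no `D_𝔔`-stable infinite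
complement. TRUE for non-CM `E/ℚ` with good ordinary reduction at the prime below `𝔔` (Serre 1968, IV-A.2 —
the named fact `serre1968_locallyNonsplit_of_not_hasCM` below); FALSE for CM curves with good ordinary reduction;
vacuous at `p = 2` (no ordinary line in the above sense). [cite: Serre1968, IV-A.2] -/
def LocallyNonsplitAt (W : WeierstrassCurve ℚ) (p : ℕ) [Fact p.Prime] (𝔔 : Ideal (absIntegers (𝓞 ℚ) ℚ)) :
    Prop :=
  ∀ X₀ : AddSubgroup (W.geomPrimaryTorsion p), IsOrdinaryLineAt W p 𝔔 X₀ → HasNoStableComplementAt W p 𝔔 X₀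

end Serre1968

/-- **Serre 1968, Ch. IV, A.2 (with Tate 1967, Thm. 4 and the Serre–Tate canonical lift) — NAMED FACT.** For every
elliptic curve `E/ℚ` (globally minimal model) WITHOUT complex multiplication and every prime `ℓ` of good ORDINARY
reduction (`ℓ ∤ a_ℓ`), at every prime `𝔔` of `\bar ℤ_ℚ` above `ℓ` the `ℓ`-power torsion `E[ℓ^∞]` is locally non-split:
`Serre1968.LocallyNonsplitAt E ℓ 𝔔`. (A `D_𝔔`-stable complement to `Ê[ℓ^∞]` would split the `ℓ`-divisible group of
`E/ℤ_ℓ` as connected × étale, making `E` the canonical lift of its reduction, hence `End_{ℚ̄}(E) ⊋ ℤ`.) The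
hypothesis `¬ HasCM` is necessary. Not proved here (named fact, D-0014); users take `(h : serre1968_locallyNonsplit_of_not_hasCM)`.
[cite: Serre1968, IV-A.2] -/
def serre1968_locallyNonsplit_of_not_hasCM : Prop :=
  ∀ (W : WeierstrassCurve ℚ) [W.IsElliptic] [W.IsGloballyMinimal], ¬ W.HasCM →
    ∀ (ℓ : ℕ) [Fact ℓ.Prime], W.HasGoodReductionAtPrime ℓ → ¬ (ℓ : ℤ) ∣ W.frobeniusTrace ℓ →
      ∀ u : HeightOneSpectrum (𝓞 ℚ), (Rat.HeightOneSpectrum.primesEquiv u : ℕ) = ℓ →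
        ∀ 𝔔 ∈ u.primesAbove, Serre1968.LocallyNonsplitAt W ℓ 𝔔

end Literature.NumberTheory.EllipticCurves
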